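import Summits.Ventures.PercRepro.PendantIdentity
import Summits.Ventures.PercRepro.ConditionalNeg
import Summits.Ventures.PercRepro.TwoMap
import Summits.Ventures.PercRepro.Rows5a

/-!
# PercRepro — the fibres of the cube by the cluster of a pendant mark (p1, gen 4; proofs/P1-5a-class.md §2, §4)

For a pendant mark `a = m 0` with its edge `g = a–h`, typer-2's identity (`pendantClassSumNonneg_iff`) reads
the class-level pendant Lemma 5a as `CS₁(G, g) ≤ 2·CS(G)`, i.e. `X(f₁, f₁) ≤ X(f₁, f₀)` on the cube of `E ∖ {g}`
(`f_b ρ = row4 Π(ρ[g := b])`).  Proof: (1) `f₀ ρᶜ = splitA (f₁ ρᶜ)` (a pendant edge does not affect the other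
marks; `row4_extendAt_false`), so the difference is a row kernel `Kd(f₁ ρ, f₁ ρᶜ)` after moving the `(⊤, A-row)`
count to the `(A-row, ⊤)` side by the involution `ρ ↦ ρᶜ`; (2) `Kd ≤ −kf` pointwise (`kd_le_neg_kf`, 225 cases);
(3) `0 ≤ Σ_ρ kf (f₁ ρ) (f₁ ρᶜ)`: FIBRE the cube by `key ρ` = the restriction of `ρ` to the edges inside the
`a`-cluster `W ρ` of `ρ[g := 1]`; a fibre is `{key ρ₀ ⊔ B : B ⊆ outF ρ₀}` (the edges outside `W`), on which the
`a`-cluster is constant (`cluster_cfgOf_eq`); when exactly one mark `p` lies in `W` the X-row is the B-row or the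
A-row of `p` according to `q ~ r` (`row4_fibre_*`), the Y-row is monotone in the refinement order, and the
two-map coordinate induction `twoMap_sum_nonneg` with the fibre kernel `fB` (local inequality `fB_loc`, diagonal
from `q ~_X r ⇒ q ~_Y r` via `cluster_sup_eq_of_cluster_eq`) gives a nonnegative fibre sum; otherwise `kf` vanishes
on the fibre (`kf_eq_zero_of_not_one`).
-/

namespace PercRepro

open Finset

namespace MultiGraph

variable {V E : Type*} (G : MultiGraph V E) [DecidableEq E]

/-! ### A pendant edge does not affect the connectivity of the other vertices -/

/-- With the pendant edge `g` of `a` open or closed, vertices other than `a` are connected alike. -/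
theorem conn_extendAt_true_iff_of_pendant {g : E} {a : V} (hg : G.fst g = a ∨ G.snd g = a)
    (hpend : ∀ e, (G.fst e = a ∨ G.snd e = a) → e = g) (ρ : Config {e // e ≠ g}) {x y : V}
    (hx : x ≠ a) (hy : y ≠ a) :
    G.Conn (extendAt g true ρ) x y ↔ G.Conn (extendAt g false ρ) x y := by
  have hclosed : extendAt g false ρ g = false := extendAt_self g false ρ
  have hiso : ∀ z, G.Conn (extendAt g false ρ) a z → a = z := fun z hz =>
    G.isolated_of_closed_pendant hclosed hpend hz
  rw [← update_extendAt_false g ρ, conn_update_true_iff]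
  constructor
  · rintro (h | ⟨h1, h2⟩ | ⟨h1, h2⟩)
    · exact h
    · exfalso
      rcases hg with hfa | hsa
      · exact hx (hiso x (hfa ▸ h1.symm)).symm
      · exact hy (hiso y (hsa ▸ h2)).symm
    · exfalso
      rcases hg with hfa | hsa
      · exact hy (hiso y (hfa ▸ h2)).symm
      · exact hx (hiso x (hsa ▸ h1.symm)).symm
  · exact Or.inl

/-- **`f₀ = splitA ∘ f₁`**: the row with `g` closed is the row with `g` open with the pendant mark split off. -/
theorem row4_extendAt_false {g : E} {m : Fin 4 → V} (hn : [m 0, m 1, m 2, m 3].Nodup)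
    (hg : G.fst g = m 0 ∨ G.snd g = m 0) (hpend : ∀ e, (G.fst e = m 0 ∨ G.snd e = m 0) → e = g)
    (ρ : Config {e // e ≠ g}) :
    row4 (G.markedPartition (extendAt g false ρ) m) =
      splitA (row4 (G.markedPartition (extendAt g true ρ) m)) := by
  have h01 : m 0 ≠ m 1 := by simp only [List.nodup_cons, List.mem_cons] at hn; tauto
  have h02 : m 0 ≠ m 2 := by simp only [List.nodup_cons, List.mem_cons] at hn; tauto
  have h03 : m 0 ≠ m 3 := by simp only [List.nodup_cons, List.mem_cons] at hn; tauto
  have hclosed : extendAt g false ρ g = false := extendAt_self g false ρ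
  have hiso : ∀ z, G.Conn (extendAt g false ρ) (m 0) z → m 0 = z := fun z hz =>
    G.isolated_of_closed_pendant hclosed hpend hz
  unfold splitA
  rw [row4, row4, rows4_rowOf4 _ (isEquivAtoms4_atoms4 _)]
  congr 1
  funext a
  rw [G.atoms4_markedPartition, G.atoms4_markedPartition]
  fin_cases a
  · rw [if_pos (by decide), decide_eq_false_iff_not]
    exact fun h => h01 (hiso _ h)
  · rw [if_pos (by decide), decide_eq_false_iff_not]
    exact fun h => h02 (hiso _ h)
  · rw [if_pos (by decide), decide_eq_false_iff_not]
    exact fun h => h03 (hiso _ h)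
  · rw [if_neg (by decide), decide_eq_decide]
    exact (G.conn_extendAt_true_iff_of_pendant hg hpend ρ h01.symm h02.symm).symm
  · rw [if_neg (by decide), decide_eq_decide]
    exact (G.conn_extendAt_true_iff_of_pendant hg hpend ρ h01.symm h03.symm).symm
  · rw [if_neg (by decide), decide_eq_decide]
    exact (G.conn_extendAt_true_iff_of_pendant hg hpend ρ h02.symm h03.symm).symm

/-! ### The fibres of the cube by the cluster of the pendant mark -/

section Fibre

variable (g : E) (a : V)

/-- The `a`-cluster of `ρ` with `g` open. -/
def pcluster (ρ : Config {e // e ≠ g}) : Set V := G.cluster (extendAt g true ρ) a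

open Classical in
/-- The restriction of `ρ` to the edges inside its `a`-cluster: the KEY of the fibre. -/
noncomputable def pkey (ρ : Config {e // e ≠ g}) : Config {e // e ≠ g} :=
  fun e => ρ e && decide (G.fst e.1 ∈ G.pcluster g a ρ ∧ G.snd e.1 ∈ G.pcluster g a ρ)

variable {G g a}

/-- An open edge of `ρ` has both ends inside the `a`-cluster or both ends outside. -/
theorem inside_or_outside {ρ : Config {e // e ≠ g}} {e : {e // e ≠ g}} (he : ρ e = true) :
    (G.fst e.1 ∈ G.pcluster g a ρ ∧ G.snd e.1 ∈ G.pcluster g a ρ) ∨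
      (G.fst e.1 ∉ G.pcluster g a ρ ∧ G.snd e.1 ∉ G.pcluster g a ρ) := by
  have hopen : extendAt g true ρ e.1 = true := by rw [extendAt_of_ne g true ρ e.2]; exact he
  have hadj : G.Conn (extendAt g true ρ) (G.fst e.1) (G.snd e.1) :=
    Conn.of_openAdj (G.openAdj_of_open _ hopen)
  by_cases h1 : G.fst e.1 ∈ G.pcluster g a ρ
  · exact Or.inl ⟨h1, Conn.trans h1 hadj⟩
  · refine Or.inr ⟨h1, fun h2 => h1 ?_⟩
    exact Conn.trans h2 hadj.symm

open Classical in
/-- `ρ[g := 1]` is the key with `g` open, joined with the open edges outside the cluster (`g` closed). -/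
theorem extendAt_eq_pkey_sup (ρ : Config {e // e ≠ g}) :
    extendAt g true ρ = extendAt g true (G.pkey g a ρ) ⊔
      extendAt g false (fun e => ρ e && decide (G.fst e.1 ∉ G.pcluster g a ρ ∧ G.snd e.1 ∉ G.pcluster g a ρ)) := by
  funext e
  by_cases he : e = g
  · subst he
    simp [extendAt_self]
  · rw [Pi.sup_apply, extendAt_of_ne g true ρ he, extendAt_of_ne g true _ he, extendAt_of_ne g false _ he]
    simp only [pkey]
    cases hρ : ρ ⟨e, he⟩
    · simp
    · rcases G.inside_or_outside (a := a) hρ with h | h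
      · simp [h.1, h.2]
      · simp [h.1, h.2]

/-- Adding edges outside the cluster of `ρ₀` to its key: `ρ₀[g := 1]`-style decomposition. -/
theorem extendAt_cfgOf_eq_sup (ρ₀ : Config {e // e ≠ g}) (B : Finset {e // e ≠ g}) :
    extendAt g true (cfgOf (G.pkey g a ρ₀) B) =
      extendAt g true (G.pkey g a ρ₀) ⊔ extendAt g false (fun e => decide (e ∈ B)) := by
  funext e
  by_cases he : e = g
  · subst he; simp [extendAt_self]
  · rw [Pi.sup_apply, extendAt_of_ne g true _ he, extendAt_of_ne g true _ he, extendAt_of_ne g false _ he]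
    rfl

variable [Fintype E]
variable (G g a)

open Classical in
/-- The edges outside the `a`-cluster of `ρ`: the FREE coordinates of the fibre. -/
noncomputable def outF (ρ : Config {e // e ≠ g}) : Finset {e // e ≠ g} :=
  univ.filter fun e => G.fst e.1 ∉ G.pcluster g a ρ ∧ G.snd e.1 ∉ G.pcluster g a ρ

open Classical in
/-- The Y-side base of the fibre: everything outside `key ρ` and outside the free coordinates. -/
noncomputable def ybase (ρ : Config {e // e ≠ g}) : Config {e // e ≠ g} :=
  fun e => !(G.pkey g a ρ e) && !decide (e ∈ G.outF g a ρ)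

open Classical in
/-- The edges touching the `a`-cluster of `ρ` (as a `Finset` of all edges, `g` included). -/
noncomputable def touchF (ρ : Config {e // e ≠ g}) : Finset E :=
  univ.filter fun e => G.fst e ∈ G.pcluster g a ρ ∨ G.snd e ∈ G.pcluster g a ρ

variable {G g a}

/-- Membership in the free coordinates. -/
theorem mem_outF {ρ : Config {e // e ≠ g}} {e : {e // e ≠ g}} :
    e ∈ G.outF g a ρ ↔ (G.fst e.1 ∉ G.pcluster g a ρ ∧ G.snd e.1 ∉ G.pcluster g a ρ) := by
  simp [outF]

/-- Membership in the touching edges. -/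
theorem mem_touchF {ρ : Config {e // e ≠ g}} {e : E} :
    e ∈ G.touchF g a ρ ↔ (G.fst e ∈ G.pcluster g a ρ ∨ G.snd e ∈ G.pcluster g a ρ) := by
  simp [touchF]

/-- A configuration with every open edge outside the cluster is closed on the touching edges. -/
theorem closed_touchF_of_outside (ρ : Config {e // e ≠ g}) (ζ : Config {e // e ≠ g})
    (hζ : ∀ e, ζ e = true → G.fst e.1 ∉ G.pcluster g a ρ ∧ G.snd e.1 ∉ G.pcluster g a ρ) :
    ∀ e ∈ G.touchF g a ρ, extendAt g false ζ e = false := by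
  intro e he
  by_cases heg : e = g
  · rw [heg]; exact extendAt_self g false ζ
  · rw [extendAt_of_ne g false ζ heg]
    cases hζe : ζ ⟨e, heg⟩
    · rfl
    · exfalso
      rw [mem_touchF] at he
      rcases he with h | h
      · exact (hζ _ hζe).1 h
      · exact (hζ _ hζe).2 h

open Classical in
/-- **The key has the same `a`-cluster as `ρ`.** -/
theorem pcluster_pkey (ρ : Config {e // e ≠ g}) : G.pcluster g a (G.pkey g a ρ) = G.pcluster g a ρ := by
  have hK : ∀ e, e ∈ G.touchF g a ρ ↔ (G.fst e ∈ G.pcluster g a ρ ∨ G.snd e ∈ G.pcluster g a ρ) :=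
    fun e => mem_touchF
  have hω := G.closed_touchF_of_outside (a := a) ρ
    (fun e => ρ e && decide (G.fst e.1 ∉ G.pcluster g a ρ ∧ G.snd e.1 ∉ G.pcluster g a ρ))
    (fun e he => by simpa using (Bool.and_eq_true_iff.1 he).2)
  have := (cluster_sup_eq_iff (G := G) a hK hω (ζ := extendAt g true (G.pkey g a ρ))).1
  rw [← G.extendAt_eq_pkey_sup] at this
  exact this rfl

/-- **The `a`-cluster is constant on the fibre.** -/
theorem pcluster_cfgOf_eq (ρ₀ : Config {e // e ≠ g}) {B : Finset {e // e ≠ g}} (hB : B ⊆ G.outF g a ρ₀) :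
    G.pcluster g a (cfgOf (G.pkey g a ρ₀) B) = G.pcluster g a ρ₀ := by
  have hK : ∀ e, e ∈ G.touchF g a ρ₀ ↔ (G.fst e ∈ G.pcluster g a ρ₀ ∨ G.snd e ∈ G.pcluster g a ρ₀) :=
    fun e => mem_touchF
  have hω := G.closed_touchF_of_outside (a := a) ρ₀ (fun e => decide (e ∈ B))
    (fun e he => mem_outF.1 (hB (of_decide_eq_true he)))
  have := (cluster_sup_eq_iff (G := G) a hK hω (ζ := extendAt g true (G.pkey g a ρ₀))).2
  rw [← G.extendAt_cfgOf_eq_sup] at this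
  exact this (G.pcluster_pkey ρ₀)

/-- Two configurations with the same key have the same `a`-cluster. -/
theorem pcluster_eq_of_pkey_eq {ρ ρ₀ : Config {e // e ≠ g}} (h : G.pkey g a ρ = G.pkey g a ρ₀) :
    G.pcluster g a ρ = G.pcluster g a ρ₀ := by
  rw [← G.pcluster_pkey ρ, h, G.pcluster_pkey ρ₀]

open Classical in
/-- **The fibre of a key is the image of the powerset of the free coordinates.** -/
theorem fibre_eq_image (ρ₀ : Config {e // e ≠ g}) :
    (univ.filter fun ρ => G.pkey g a ρ = G.pkey g a ρ₀) =
      (G.outF g a ρ₀).powerset.image (cfgOf (G.pkey g a ρ₀)) := by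
  classical
  ext ρ
  simp only [Finset.mem_filter, Finset.mem_univ, true_and, Finset.mem_image, Finset.mem_powerset]
  constructor
  · intro hkey
    have hW := G.pcluster_eq_of_pkey_eq hkey
    refine ⟨univ.filter fun e => ρ e = true ∧ G.fst e.1 ∉ G.pcluster g a ρ ∧ G.snd e.1 ∉ G.pcluster g a ρ,
      ?_, ?_⟩
    · intro e he
      rw [mem_outF, ← hW]
      exact (Finset.mem_filter.1 he).2.2
    · funext e
      rw [← hkey]
      simp only [cfgOf, pkey, Finset.mem_filter, Finset.mem_univ, true_and]
      cases hρ : ρ e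
      · simp
      · rcases G.inside_or_outside (a := a) hρ with h | h
        · simp [h.1, h.2]
        · simp [h.1, h.2]
  · rintro ⟨B, hB, rfl⟩
    have hW := G.pcluster_cfgOf_eq ρ₀ hB
    funext e
    simp only [pkey, hW, cfgOf]
    by_cases hin : G.fst e.1 ∈ G.pcluster g a ρ₀ ∧ G.snd e.1 ∈ G.pcluster g a ρ₀
    · have heB : e ∉ B := fun h => (mem_outF.1 (hB h)).1 hin.1
      simp [hin, heB]
    · simp [hin]

/-- `cfgOf (key ρ₀)` is injective on the subsets of the free coordinates. -/
theorem cfgOf_pkey_injOn (ρ₀ : Config {e // e ≠ g}) :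
    Set.InjOn (cfgOf (G.pkey g a ρ₀)) ↑(G.outF g a ρ₀).powerset := by
  intro B hB B' hB' h
  rw [Finset.coe_powerset, Set.mem_preimage, Set.mem_powerset_iff, Finset.coe_subset] at hB hB'
  ext e
  by_cases he : e ∈ G.outF g a ρ₀
  · have hkey : G.pkey g a ρ₀ e = false := by
      simp only [pkey]
      have := (mem_outF.1 he).1
      simp [this]
    have := congrFun h e
    simp only [cfgOf, hkey, Bool.false_or, decide_eq_decide] at this
    exact this
  · exact ⟨fun h' => absurd (hB h') he, fun h' => absurd (hB' h') he⟩

/-- The complement of a fibre element is the Y-base with the complementary free coordinates. -/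
theorem compl_cfgOf_pkey (ρ₀ : Config {e // e ≠ g}) {B : Finset {e // e ≠ g}} (hB : B ⊆ G.outF g a ρ₀) :
    (cfgOf (G.pkey g a ρ₀) B)ᶜ = cfgOf (G.ybase g a ρ₀) (G.outF g a ρ₀ \ B) := by
  funext e
  simp only [Pi.compl_apply, cfgOf, ybase, Finset.mem_sdiff]
  by_cases he : e ∈ G.outF g a ρ₀
  · have hkey : G.pkey g a ρ₀ e = false := by
      simp only [pkey]
      have := (mem_outF.1 he).1
      simp [this]
    by_cases heB : e ∈ B <;> simp [hkey, he, heB]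
  · have heB : e ∉ B := fun h => he (hB h)
    simp [he, heB]

end Fibre

end MultiGraph

end PercRepro
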